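import Literature.MathematicalPhysics.QuantumLattice.DWaveSourceProofs
import HarnessLib

/-!
# The `d`-wave order parameter: the `h`-liminf is an infimum, energy form, refuted strengthenings

API theorems for `dWaveOrderParameter U μ = liminf_{h→0⁺} liminf_L dWaveSourceDensity (L+1) U μ h`
(`DWaveSource.lean`), family `hubbard` / trunk T-QLATTICE, written by the standing disprover of crux
`WcbcsBcsConstruction` (route `HubbardSuperconductivity/WeakCouplingBCS`: `exp(-C/U²) ≤ dWaveOrderParameter U μ`
at a density-matched `μ`). All proved; no named facts, no new definitions (the inner liminf
`F(U,μ,h) = liminf_L dWaveSourceDensity (L+1) U μ h`, the sourced energies `E_L(U,μ,h) = E₀(dWaveSourceTorus L U μ h)`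
and the a priori constant `B_d = 2Σ_e|d(e)/√2| = 4√2` are written out).

* MONOTONICITY: `F(U,μ,·)` is non-decreasing on `[0,∞)`, `0 ≤ F ≤ B_d` there; hence the outer `liminf_{h→0⁺}`
  is an infimum: `dWaveOrderParameter U μ ≤ F(U,μ,h)` for EVERY `h > 0`
  (`dWaveOrderParameter_le_liminf`: an upper bound at ONE positive source strength, uniform in large `L`,
  bounds the order parameter) and conversely `(∀ h ∈ (0,h₀), ε ≤ F(U,μ,h)) → ε ≤ dWaveOrderParameter U μ`;
  `0 ≤ dWaveOrderParameter U μ ≤ B_d` for all `U, μ`.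
* ENERGY FORM of a floor `ε ≤ dWaveOrderParameter U μ`: it FORCES, for every `h > 0`,
  `ε ≤ liminf_L [E_{L+1}(h) - E_{L+1}(2h)]/(2h(L+1)²)`, and it FOLLOWS from
  `ε ≤ liminf_L [E_{L+1}(0) - E_{L+1}(h)]/(2h(L+1)²)` for all `h ∈ (0,h₀)`: the order clause is a statement
  about sourced ground-state ENERGIES only. Corollary (`dWaveOrderParameter_eq_zero_of_sublinear_gain`):
  an energy response `E(0) - E(2h) ≤ Φ(h)·L²` with `Φ(h)/h → 0` kills the order parameter (the free-gas
  situation, `Φ(h) ∼ h² log(1/h)`), so positivity of the order parameter = a LINEAR energy response.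
* REFUTED STRENGTHENINGS (which features of the definition are load-bearing): with the source switched
  off before `L → ∞` the liminf is `0` (`liminf_dWaveSourceDensity_zero`), so no positive floor survives
  (`not_exp_le_liminf_sourceFree`); with the NON-punctured filter `𝓝[≥] 0` the double liminf is `≤ 0`
  for every `(U, μ)` (`liminf_nhdsGE_liminf_dWaveSourceDensity_le_zero`).
* STAIRCASE FORM (appended 2026-08-15, crux-triage of `WcbcsBcsConstruction`): the closed form
  `dWaveOrderParameter U μ = ⨅_{h>0} F(U,μ,h)` (`dWaveOrderParameter_eq_iInf`) and the iff
  `ε ≤ dWaveOrderParameter U μ ↔ ∀ h > 0, ε ≤ F(U,μ,h)` (`le_dWaveOrderParameter_iff_forall`): the order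
  clause is the conjunction of ALL its stairs, so a floor on stairs bounded away from `h = 0` proves nothing.

Sources: T. Koma, H. Tasaki, J. Stat. Phys. 76 (1994) 745, §1 (order parameters: source, then
`Λ ↑ ℤ^d`, then `h ↓ 0`; the order of limits matters) — the statements below are folklore consequences of
the variational inequalities of `GroundStateSourceBounds.lean`. Tree search: `lean search
"dWaveOrderParameter_"` — only `dWaveOrderParameter_eq` (unfolding).
-/

noncomputable section

namespace Literature.MathematicalPhysics.QuantumLattice

open Matrix Finset Filter Literature.Probability.LatticeModels
open scoped Matrix.Norms.L2Operator ComplexOrder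
open _root_.Topology

/-! ### The inner liminf: bounds and monotonicity -/

section Inner

/-- Pointwise upper bound `dWaveSourceDensity ≤ B_d`. [folklore] -/
theorem dWaveSourceDensity_le_const (L : ℕ) [NeZero L] (U μ h : ℝ) :
    dWaveSourceDensity L U μ h ≤ 2 * ∑ e ∈ insert (0 : Site 2) unitSteps, |dWaveFormFactor e / Real.sqrt 2| :=
  (le_abs_self _).trans (abs_dWaveSourceDensity_le L U μ h)

/-- The inner liminf `F(U,μ,h) = liminf_L dWaveSourceDensity (L+1) U μ h` is non-decreasing in `h ≥ 0`.
[cite: KomaTasaki1994, §1] -/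
theorem liminf_dWaveSourceDensity_mono (U μ : ℝ) {h h' : ℝ} (hh : 0 ≤ h) (hle : h ≤ h') :
    liminf (fun L : ℕ => dWaveSourceDensity (L + 1) U μ h) atTop ≤
      liminf (fun L : ℕ => dWaveSourceDensity (L + 1) U μ h') atTop := by
  refine liminf_le_liminf (Eventually.of_forall fun L => dWaveSourceDensity_mono U μ hle) ?_ ?_
  · exact isBoundedUnder_of_eventually_ge (a := 0)
      (Eventually.of_forall fun L => dWaveSourceDensity_nonneg U μ hh)
  · exact isCoboundedUnder_ge_of_eventually_le atTop
      (x := 2 * ∑ e ∈ insert (0 : Site 2) unitSteps, |dWaveFormFactor e / Real.sqrt 2|)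
      (Eventually.of_forall fun L => dWaveSourceDensity_le_const _ U μ h')

/-- `0 ≤ F(U,μ,h)` for `h ≥ 0`. [folklore] -/
theorem liminf_dWaveSourceDensity_nonneg (U μ : ℝ) {h : ℝ} (hh : 0 ≤ h) :
    0 ≤ liminf (fun L : ℕ => dWaveSourceDensity (L + 1) U μ h) atTop := by
  refine le_liminf_of_le ?_ (Eventually.of_forall fun L => dWaveSourceDensity_nonneg U μ hh)
  exact isCoboundedUnder_ge_of_eventually_le atTop
      (x := 2 * ∑ e ∈ insert (0 : Site 2) unitSteps, |dWaveFormFactor e / Real.sqrt 2|)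
      (Eventually.of_forall fun L => dWaveSourceDensity_le_const _ U μ h)

/-- `F(U,μ,h) ≤ B_d` for `h ≥ 0`. [folklore] -/
theorem liminf_dWaveSourceDensity_le_const (U μ : ℝ) {h : ℝ} (hh : 0 ≤ h) :
    liminf (fun L : ℕ => dWaveSourceDensity (L + 1) U μ h) atTop ≤
      2 * ∑ e ∈ insert (0 : Site 2) unitSteps, |dWaveFormFactor e / Real.sqrt 2| := by
  refine liminf_le_of_frequently_le
    (Frequently.of_forall fun L => dWaveSourceDensity_le_const _ U μ h) ?_
  exact isBoundedUnder_of_eventually_ge (a := 0)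
      (Eventually.of_forall fun L => dWaveSourceDensity_nonneg U μ hh)

/-- The source-free inner liminf is `0` (the slice `h = 0` vanishes identically). [cite: KomaTasaki1994, §1] -/
theorem liminf_dWaveSourceDensity_zero (U μ : ℝ) :
    liminf (fun L : ℕ => dWaveSourceDensity (L + 1) U μ 0) atTop = 0 := by
  have : (fun L : ℕ => dWaveSourceDensity (L + 1) U μ 0) = fun _ => 0 :=
    funext fun L => dWaveSourceDensity_zero _ _ _
  rw [this, liminf_const]

end Inner

/-! ### The outer liminf is an infimum: levers for both sides -/

section Outer

/-- **Upper lever**: `dWaveOrderParameter U μ ≤ F(U,μ,h)` for EVERY `h > 0` — an upper bound on the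
sourced pair density at one positive source strength, uniform in large `L`, bounds the order parameter.
[cite: KomaTasaki1994, §1] -/
theorem dWaveOrderParameter_le_liminf (U μ : ℝ) {h : ℝ} (hh : 0 < h) :
    dWaveOrderParameter U μ ≤ liminf (fun L : ℕ => dWaveSourceDensity (L + 1) U μ h) atTop := by
  rw [dWaveOrderParameter]
  have hev : ∀ᶠ h' in 𝓝[>] (0 : ℝ), liminf (fun L : ℕ => dWaveSourceDensity (L + 1) U μ h') atTop ≤
      liminf (fun L : ℕ => dWaveSourceDensity (L + 1) U μ h) atTop := by
    filter_upwards [Ioo_mem_nhdsGT hh] with h' hh'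
    exact liminf_dWaveSourceDensity_mono U μ hh'.1.le hh'.2.le
  have hbdd : ∀ᶠ h' in 𝓝[>] (0 : ℝ), 0 ≤ liminf (fun L : ℕ => dWaveSourceDensity (L + 1) U μ h') atTop := by
    filter_upwards [self_mem_nhdsWithin] with h' hh'
    exact liminf_dWaveSourceDensity_nonneg U μ (le_of_lt hh')
  exact liminf_le_of_frequently_le hev.frequently (isBoundedUnder_of_eventually_ge hbdd)

/-- **Lower lever**: a floor on the inner liminf for all small `h > 0` is a floor on the order parameter.
[cite: KomaTasaki1994, §1] -/
theorem le_dWaveOrderParameter_of_forall (U μ : ℝ) {ε h₀ : ℝ} (hh₀ : 0 < h₀)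
    (H : ∀ h ∈ Set.Ioo 0 h₀, ε ≤ liminf (fun L : ℕ => dWaveSourceDensity (L + 1) U μ h) atTop) :
    ε ≤ dWaveOrderParameter U μ := by
  rw [dWaveOrderParameter]
  refine le_liminf_of_le ?_ ?_
  · refine isCoboundedUnder_ge_of_eventually_le _
      (x := 2 * ∑ e ∈ insert (0 : Site 2) unitSteps, |dWaveFormFactor e / Real.sqrt 2|) ?_
    filter_upwards [self_mem_nhdsWithin] with h' hh'
    exact liminf_dWaveSourceDensity_le_const U μ (le_of_lt hh')
  · filter_upwards [Ioo_mem_nhdsGT hh₀] with h hh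
    exact H h hh

/-- The order parameter is never negative (for ALL `U, μ`): no sign consideration can refute a positive
floor. [cite: KomaTasaki1994, §1] -/
theorem dWaveOrderParameter_nonneg (U μ : ℝ) : 0 ≤ dWaveOrderParameter U μ :=
  le_dWaveOrderParameter_of_forall U μ zero_lt_one fun _ hh =>
    liminf_dWaveSourceDensity_nonneg U μ hh.1.le

/-- … and never exceeds the a priori constant `B_d = 4√2`. [folklore] -/
theorem dWaveOrderParameter_le_const (U μ : ℝ) :
    dWaveOrderParameter U μ ≤ 2 * ∑ e ∈ insert (0 : Site 2) unitSteps, |dWaveFormFactor e / Real.sqrt 2| :=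
  (dWaveOrderParameter_le_liminf U μ zero_lt_one).trans
    (liminf_dWaveSourceDensity_le_const U μ zero_le_one)

end Outer

/-! ### Energy form of a floor on the order parameter -/

section EnergyForm

variable {L : ℕ} [NeZero L]

/-- Pointwise: `density(h) ≤ (E(h) - E(2h)) / (2hL²)` for `h > 0`. [cite: KomaTasaki1994, §1] -/
theorem dWaveSourceDensity_le_energyDrop_div (U μ : ℝ) {h : ℝ} (hh : 0 < h) :
    dWaveSourceDensity L U μ h ≤
      ((dWaveSourceTorus L U μ h).groundEnergy - (dWaveSourceTorus L U μ (2 * h)).groundEnergy) /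
        (2 * h * (L : ℝ) ^ 2) := by
  have key := dWaveSourceDensity_mul_le_groundEnergy_drop (L := L) U μ h (2 * h)
  have hL := cast_sq_pos_of_neZero L
  have hpos : (0 : ℝ) < 2 * h * (L : ℝ) ^ 2 := by positivity
  rw [le_div_iff₀ hpos]
  nlinarith [key]

/-- Pointwise: `(E(0) - E(h)) / (2hL²) ≤ density(h)` for `h > 0`. [cite: KomaTasaki1994, §1] -/
theorem energyGain_div_le_dWaveSourceDensity (U μ : ℝ) {h : ℝ} (hh : 0 < h) :
    ((dWaveSourceTorus L U μ 0).groundEnergy - (dWaveSourceTorus L U μ h).groundEnergy) /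
        (2 * h * (L : ℝ) ^ 2) ≤ dWaveSourceDensity L U μ h := by
  have key := groundEnergy_gain_le_dWaveSourceDensity (L := L) U μ h
  have hL := cast_sq_pos_of_neZero L
  have hpos : (0 : ℝ) < 2 * h * (L : ℝ) ^ 2 := by positivity
  rw [div_le_iff₀ hpos]
  nlinarith [key]

/-- Pointwise a priori bound `(E(h) - E(2h))/(2hL²) ≤ 2B_d` for `h > 0`. [folklore] -/
theorem energyDrop_div_le_const (U μ : ℝ) {h : ℝ} (hh : 0 < h) :
    ((dWaveSourceTorus L U μ h).groundEnergy - (dWaveSourceTorus L U μ (2 * h)).groundEnergy) /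
        (2 * h * (L : ℝ) ^ 2) ≤
      2 * (2 * ∑ e ∈ insert (0 : Site 2) unitSteps, |dWaveFormFactor e / Real.sqrt 2|) := by
  have h1 := groundEnergy_gain_le_dWaveSourceDensity (L := L) U μ (2 * h)
  have h2 := groundEnergy_dWaveSourceTorus_le (L := L) U μ h
  have h3 := dWaveSourceDensity_le_const L U μ (2 * h)
  have hL := cast_sq_pos_of_neZero L
  have hpos : (0 : ℝ) < 2 * h * (L : ℝ) ^ 2 := by positivity
  rw [div_le_iff₀ hpos]
  have h4 : 2 * (2 * h) * (L : ℝ) ^ 2 * dWaveSourceDensity L U μ (2 * h) ≤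
      2 * (2 * h) * (L : ℝ) ^ 2 *
        (2 * ∑ e ∈ insert (0 : Site 2) unitSteps, |dWaveFormFactor e / Real.sqrt 2|) :=
    mul_le_mul_of_nonneg_left h3 (by positivity)
  nlinarith [h1, h2, h4]

/-- **Necessary condition (energy form)**: a floor `ε ≤ dWaveOrderParameter U μ` forces, for EVERY
`h > 0`, `ε ≤ liminf_L [E_{L+1}(h) - E_{L+1}(2h)] / (2h(L+1)²)` — the sourced ground-state energy per
site keeps dropping at rate `≥ 2ε` between `h` and `2h`, however small `h`. [cite: KomaTasaki1994, §1] -/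
theorem le_liminf_energyDrop_of_le_dWaveOrderParameter (U μ : ℝ) {ε h : ℝ} (hh : 0 < h)
    (hε : ε ≤ dWaveOrderParameter U μ) :
    ε ≤ liminf (fun L : ℕ => ((dWaveSourceTorus (L + 1) U μ h).groundEnergy -
        (dWaveSourceTorus (L + 1) U μ (2 * h)).groundEnergy) / (2 * h * (((L + 1 : ℕ) : ℝ)) ^ 2)) atTop := by
  refine (hε.trans (dWaveOrderParameter_le_liminf U μ hh)).trans ?_
  refine liminf_le_liminf (Eventually.of_forall fun L => ?_) ?_ ?_
  · exact dWaveSourceDensity_le_energyDrop_div U μ hh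
  · exact isBoundedUnder_of_eventually_ge (a := 0)
      (Eventually.of_forall fun L => dWaveSourceDensity_nonneg U μ hh.le)
  · exact isCoboundedUnder_ge_of_eventually_le atTop
      (x := 2 * (2 * ∑ e ∈ insert (0 : Site 2) unitSteps, |dWaveFormFactor e / Real.sqrt 2|))
      (Eventually.of_forall fun L => energyDrop_div_le_const U μ hh)

/-- **Sufficient condition (energy form)**: a floor on the LINEAR energy gain,
`ε ≤ liminf_L [E_{L+1}(0) - E_{L+1}(h)] / (2h(L+1)²)` for all `h ∈ (0, h₀)`, gives `ε ≤ dWaveOrderParameter U μ`.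
[cite: KomaTasaki1994, §1] -/
theorem le_dWaveOrderParameter_of_le_liminf_energyGain (U μ : ℝ) {ε h₀ : ℝ} (hh₀ : 0 < h₀)
    (H : ∀ h ∈ Set.Ioo 0 h₀, ε ≤ liminf (fun L : ℕ =>
      ((dWaveSourceTorus (L + 1) U μ 0).groundEnergy - (dWaveSourceTorus (L + 1) U μ h).groundEnergy) /
        (2 * h * (((L + 1 : ℕ) : ℝ)) ^ 2)) atTop) :
    ε ≤ dWaveOrderParameter U μ := by
  refine le_dWaveOrderParameter_of_forall U μ hh₀ fun h hh => (H h hh).trans ?_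
  refine liminf_le_liminf (Eventually.of_forall fun L => ?_) ?_ ?_
  · exact energyGain_div_le_dWaveSourceDensity U μ hh.1
  · refine isBoundedUnder_of_eventually_ge (a := 0) (Eventually.of_forall fun L => ?_)
    have := groundEnergy_dWaveSourceTorus_le (L := L + 1) U μ h
    have hL := cast_sq_pos_of_neZero (L + 1)
    have hh1 := hh.1
    have hpos : (0 : ℝ) < 2 * h * (((L + 1 : ℕ) : ℝ)) ^ 2 := by positivity
    exact div_nonneg (by linarith) hpos.le
  · exact isCoboundedUnder_ge_of_eventually_le atTop
      (x := 2 * ∑ e ∈ insert (0 : Site 2) unitSteps, |dWaveFormFactor e / Real.sqrt 2|)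
      (Eventually.of_forall fun L => dWaveSourceDensity_le_const _ U μ h)

/-- **Sub-linear energy response kills the order parameter.** If the energy gained from the source is
`o(h)` per site uniformly in large `L` — `E_{L+1}(0) - E_{L+1}(2h) ≤ Φ(h)(L+1)²` eventually in `L`, for
all small `h > 0`, with `Φ(h)/(2h) → 0` — then `dWaveOrderParameter U μ = 0`. (Free fermions respond with
`Φ(h) ∼ h² log(1/h)`; a positive order parameter is exactly a LINEAR response.) [cite: KomaTasaki1994, §1] -/
theorem dWaveOrderParameter_eq_zero_of_sublinear_gain (U μ : ℝ) (Φ : ℝ → ℝ)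
    (hΦ : Tendsto (fun h => Φ h / (2 * h)) (𝓝[>] 0) (𝓝 0))
    (H : ∀ᶠ h in 𝓝[>] (0 : ℝ), ∀ᶠ L : ℕ in atTop,
      (dWaveSourceTorus (L + 1) U μ 0).groundEnergy - (dWaveSourceTorus (L + 1) U μ (2 * h)).groundEnergy ≤
        Φ h * (((L + 1 : ℕ) : ℝ)) ^ 2) :
    dWaveOrderParameter U μ = 0 := by
  refine le_antisymm ?_ (dWaveOrderParameter_nonneg U μ)
  refine ge_of_tendsto hΦ ?_
  filter_upwards [H, self_mem_nhdsWithin] with h hH hh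
  have hh' : (0 : ℝ) < h := hh
  refine (dWaveOrderParameter_le_liminf U μ hh').trans ?_
  refine liminf_le_of_frequently_le (Eventually.frequently ?_) ?_
  · filter_upwards [hH] with L hL
    refine (dWaveSourceDensity_le_energyDrop_div U μ hh').trans ?_
    have hE := groundEnergy_dWaveSourceTorus_le (L := L + 1) U μ h
    have hL2 := cast_sq_pos_of_neZero (L + 1)
    have hpos : (0 : ℝ) < 2 * h * (((L + 1 : ℕ) : ℝ)) ^ 2 := by positivity
    rw [div_le_iff₀ hpos]
    have : Φ h / (2 * h) * (2 * h * (((L + 1 : ℕ) : ℝ)) ^ 2) = Φ h * (((L + 1 : ℕ) : ℝ)) ^ 2 := by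
      field_simp
    rw [this]
    linarith
  · exact isBoundedUnder_of_eventually_ge (a := 0)
      (Eventually.of_forall fun L => dWaveSourceDensity_nonneg U μ hh'.le)

end EnergyForm

/-! ### Refuted strengthenings: the source and the punctured filter are load-bearing -/

section Strengthenings

/-- No positive floor survives switching the source off before the thermodynamic limit:
`¬ (exp(-C/U²) ≤ liminf_L dWaveSourceDensity (L+1) U μ 0)` for all `C, U, μ`. [cite: KomaTasaki1994, §1] -/
theorem not_exp_le_liminf_sourceFree (C U μ : ℝ) :
    ¬ Real.exp (-C / U ^ 2) ≤ liminf (fun L : ℕ => dWaveSourceDensity (L + 1) U μ 0) atTop := by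
  rw [liminf_dWaveSourceDensity_zero]
  exact (Real.exp_pos _).not_ge

/-- With the NON-punctured right neighbourhood `𝓝[≥] 0` the double liminf collapses to `≤ 0` for every
`(U, μ)` (the slice `h = 0` is identically zero and lies in every neighbourhood): the punctured filter
`𝓝[>] 0` in `dWaveOrderParameter` is load-bearing. [cite: KomaTasaki1994, §1] -/
theorem liminf_nhdsGE_liminf_dWaveSourceDensity_le_zero (U μ : ℝ) :
    liminf (fun h : ℝ => liminf (fun L : ℕ => dWaveSourceDensity (L + 1) U μ h) atTop) (𝓝[≥] 0) ≤ 0 := by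
  refine liminf_le_of_frequently_le ?_ ?_
  · refine frequently_iff.2 fun {S} hS => ⟨0, mem_of_mem_nhdsWithin Set.self_mem_Ici hS, ?_⟩
    rw [liminf_dWaveSourceDensity_zero]
  · refine isBoundedUnder_of_eventually_ge (a := 0) ?_
    filter_upwards [self_mem_nhdsWithin] with h hh using liminf_dWaveSourceDensity_nonneg U μ hh

/-- Hence no positive floor survives the closed filter either. [cite: KomaTasaki1994, §1] -/
theorem not_exp_le_liminf_nhdsGE (C U μ : ℝ) :
    ¬ Real.exp (-C / U ^ 2) ≤
      liminf (fun h : ℝ => liminf (fun L : ℕ => dWaveSourceDensity (L + 1) U μ h) atTop) (𝓝[≥] 0) :=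
  fun h => (Real.exp_pos _).not_ge (h.trans (liminf_nhdsGE_liminf_dWaveSourceDensity_le_zero U μ))

end Strengthenings

/-! ### Staircase form: the outer liminf is the infimum over all positive sources -/

section Staircase

/-- **Staircase form of the order parameter.** Since `h ↦ F(U,μ,h) = liminf_L dWaveSourceDensity (L+1) U μ h`
is non-decreasing and non-negative on `h > 0`, the outer `liminf_{h → 0⁺}` is the infimum over ALL positive
source strengths: `dWaveOrderParameter U μ = ⨅_{h>0} F(U,μ,h)`. [cite: KomaTasaki1994, §1] -/
theorem dWaveOrderParameter_eq_iInf (U μ : ℝ) :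
    dWaveOrderParameter U μ =
      ⨅ h : Set.Ioi (0 : ℝ), liminf (fun L : ℕ => dWaveSourceDensity (L + 1) U μ h) atTop := by
  haveI : Nonempty (Set.Ioi (0 : ℝ)) := ⟨⟨1, Set.mem_Ioi.2 one_pos⟩⟩
  refine le_antisymm (le_ciInf fun h => dWaveOrderParameter_le_liminf U μ h.2) ?_
  refine le_dWaveOrderParameter_of_forall U μ zero_lt_one fun h hh => ?_
  have hbdd : BddBelow (Set.range fun h' : Set.Ioi (0 : ℝ) =>
      liminf (fun L : ℕ => dWaveSourceDensity (L + 1) U μ h') atTop) := by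
    refine ⟨0, ?_⟩
    rintro _ ⟨h', rfl⟩
    exact liminf_dWaveSourceDensity_nonneg U μ (le_of_lt h'.2)
  exact ciInf_le hbdd ⟨h, hh.1⟩

/-- The order clause in staircase form: a floor `ε` on the order parameter is EXACTLY a floor `ε` on every
stair `F(U,μ,h)`, `h > 0` — in particular a floor on stairs bounded away from `h = 0` proves nothing.
[cite: KomaTasaki1994, §1] -/
theorem le_dWaveOrderParameter_iff_forall (U μ ε : ℝ) :
    ε ≤ dWaveOrderParameter U μ ↔
      ∀ h : ℝ, 0 < h → ε ≤ liminf (fun L : ℕ => dWaveSourceDensity (L + 1) U μ h) atTop :=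
  ⟨fun hε _ hh => hε.trans (dWaveOrderParameter_le_liminf U μ hh),
   fun H => le_dWaveOrderParameter_of_forall U μ zero_lt_one fun h hh => H h hh.1⟩

end Staircase

end Literature.MathematicalPhysics.QuantumLattice

end
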